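import HarnessLib
import Summits.Ventures.WeilGRH.OneCompletePrimesFrom17
import Summits.Ventures.WeilGRH.OneCompleteMod13All

/-!
# GRH arm (rh-explicit, venture WeilGRH): Weil positivity on `[−1, 1]` for EVERY non-principal Dirichlet character of EVERY prime modulus `p ≥ 13`

Cell `rh-explicit`, WEIL TRACK — GRH ARM (seat weil-grh-1 gen12).  Pure assembly: `OneCompletePrimesFrom17` (`p ≥ 17`) extended by the level `13`
(`OneCompleteMod13All`: even complex classes by weil-grh-2's checker-K χ-cells, the real class by the island `CellMod13One`, the odd classes by weil-grh-3's
format-D-K lattice certificates incl. the exact-window class 13.5).  With the principal failures of `UniformFloor.not_weilPositivityOnChar_one_principal_of_prime_le`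
(`p ≤ 73`) and the uniform floor (`p ≥ 79`) the `t = 1` picture for prime moduli `p ≥ 13` is complete: the failing set is `{χ₀}` for `p ≤ 73` and empty from `79` on.
(Primes `2, 3, 5, 7, 11` are not claimed: `2` has no non-principal character; `3, 5, 7, 11` wait for small-conductor certificates at `t = 1`.)
Pure assembly; RH/GRH-free; standard axioms.
-/

noncomputable section

namespace Summit.Ventures.WeilGRH.OneCompletePrimesFrom13
open Literature.NumberTheory.LFunctions

/-- ★★★ **Every non-principal Dirichlet character of every PRIME modulus `p ≥ 13` satisfies Weil positivity on `[−1, 1]`.**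
[cite: Weil1952FormulesExplicites, (11) pp. 261–262 and the «lemme» p. 262] -/
theorem weilPositivityOnChar_one_of_prime_ge_13 {p : ℕ} (hp : p.Prime) (h13 : 13 ≤ p)
    (χ : DirichletCharacter ℂ p) (hχ : χ ≠ 1) : WeilPositivityOnChar χ 1 := by
  by_cases h17 : 17 ≤ p
  · exact OneCompletePrimesFrom17.weilPositivityOnChar_one_of_prime_ge_17 hp h17 χ hχ
  · have key : p = 13 := by
      have h16 : p ≤ 16 := by omega
      interval_cases p <;> first | rfl | norm_num at hp
    subst key
    exact OneCompleteMod13All.weilPositivityOnChar_mod13_one χ hχ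

/-- ★★★ **PRIME MODULI `p ≥ 13`: every non-principal character is Weil-positive on every window `[−t, t]`, `t ≤ 1`.** [folklore] -/
theorem weilPositivityOnChar_of_le_one_of_prime_ge_13 {p : ℕ} (hp : p.Prime) (h13 : 13 ≤ p)
    (χ : DirichletCharacter ℂ p) (hχ : χ ≠ 1) {t : ℝ} (ht : t ≤ 1) : WeilPositivityOnChar χ t := fun g hg hsupp ↦
  weilPositivityOnChar_one_of_prime_ge_13 hp h13 χ hχ g hg (hsupp.trans (Set.Icc_subset_Icc (by linarith) ht))

/-- ★★★ **PRIME MODULI `13 ≤ p ≤ 73`: EXACTLY the principal character fails Weil positivity on `[−1, 1]`.**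
[cite: Weil1952FormulesExplicites, (11) pp. 261–262 and the «lemme» p. 262] -/
theorem weilPositivityOnChar_one_iff_ne_one_of_prime_ge_13 {p : ℕ} (hp : p.Prime) (h13 : 13 ≤ p) (h73 : p ≤ 73)
    (χ : DirichletCharacter ℂ p) : WeilPositivityOnChar χ 1 ↔ χ ≠ 1 :=
  ⟨fun h h1 ↦ UniformFloor.not_weilPositivityOnChar_one_principal_of_prime_le hp h73 (h1 ▸ h),
   weilPositivityOnChar_one_of_prime_ge_13 hp h13 χ⟩

/-- ★★★ **For a prime `p ≥ 13` the `t = 1` failing set is `{1}` when `p ≤ 73` and empty when `p ≥ 79`.** [folklore] -/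
theorem not_weilPositivityOnChar_one_iff_of_prime_ge_13 {p : ℕ} (hp : p.Prime) (h13 : 13 ≤ p) (χ : DirichletCharacter ℂ p) :
    ¬ WeilPositivityOnChar χ 1 ↔ (χ = 1 ∧ p ≤ 73) := by
  by_cases h17 : 17 ≤ p
  · exact OneCompletePrimesFrom17.not_weilPositivityOnChar_one_iff_of_prime_ge_17 hp h17 χ
  · have h73 : p ≤ 73 := by omega
    rw [weilPositivityOnChar_one_iff_ne_one_of_prime_ge_13 hp h13 h73, not_ne_iff]
    exact ⟨fun h ↦ ⟨h, h73⟩, fun h ↦ h.1⟩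

end Summit.Ventures.WeilGRH.OneCompletePrimesFrom13

end
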